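import Summits.QuantumFields.YangMills.Theorems.FluctuationComparisonRegPrIntLS2BetaTwoCornerEdge
import Summits.QuantumFields.YangMills.Theorems.FluctuationComparisonRegPrIntLS2BetaBoundPeano
import HarnessLib

/-!
# S2β · DET-REP (B) — CORNERS IN THE TUBE: the NON-base corner rows of `EdgeRows` from ONE displayed letter
# «the minimiser's pivot–gauge orbit meets the transversal slice of the tube of record»

Cell `ym3-torus` (rung R3: continuum `SU(2)` Yang–Mills on `T³` — NOT `d = 4`, NOT infinite volume, NOT a mass gap, NOT Clay); seat
`ymfull-r3-prover-4` g0 (R590-ym (a) item (4), DET-REP (B)); definition-free helper of the crux `stmt-QuantumFields-20520`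
(`--supports … --as helper`, NOT a proof of it and NOT a proof of any registered stub).  Registry of record:
`Cruxes/FluctuationComparisonRegPrIntL/Lines/semiclassical_s2beta.lean` v11.4, `def DetRepB` :1072–1098 (`stub_detRepB` :1407).

WHERE THIS SITS.  `DetRepB` asserts, per interior window quadrilateral `U V W Z`, `∃ (tube) I (x₀ y₀ x₁ y₁), TubeRows ∧ IsOpen I ∧ (0 ∈ I ∧ 1 ∈ I) ∧
EdgeRows(b; U → V; x₀, y₀) ∧ EdgeRows(b; W → Z; x₁, y₁) ∧ DETN ∧ JACW`.  The tube third is supplied by text (✓`…S2BetaTubeOfRecord.exists_tubeRows`,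
✓`…S2BetaCornerOfRecord.exists_tubeRows_pos`: px21 g11's E3″ chart through ANY fine field `U₀`, `σ 0 = U₀`); under the (E0) re-cut the edge rows are
inhabited by LOCALLY CONSTANT two-corner data once the PER-VALUE CORNER ROWS hold at both corners (✓`…S2BetaTwoCornerEdge.edgeRows_text_twoCorners`), and
the BASE corner's rows hold at `y = 0` (✓`…S2BetaCornerOfRecord.cornerRows_base_text`).  What was left open there («the organ»): the corner rows at the
THREE OTHER corners, whose minimisers live in other fibres and are «read in `U₀`'s tube».  THIS FILE discharges them from ONE displayed letter per corner:

  **(Q-TUBE)** `∃ k y, y ∈ UV ∧ 0 < jV y ∧ pivotAct (iterCentralBond (K−J)) k (σ y) = U₁` — the minimising small-field history `U₁` over the corner datum lies,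
  UP TO THE ENLARGED GROUP `residualSubgroup × SU(2)^{pivots}` (ANY element, not only those near `1`), ON THE TRANSVERSAL SLICE `σ(UV)` of the tube.

* §0 `pivotAct_inv_apply`, `mem_carrier_of_pivotAct_mem` — group bookkeeping (`k⁻¹ • (k • z) = z`; the carrier invariance clause of `ChartRows` pulled back).
* §1 ★★ `cornerRows_text_of_pivotAct_eq` — from (Q-TUBE) at a corner `X` with `U₁ ∈ argminHist X` (unfolded) and FOUR clauses of the line's `ChartRows` at `X`
  (carrier invariance under `pivotAct`, invariance of the action through the chart, invariance of the `Sf`-event, RECOGNITION of live fibre points), the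
  per-value corner rows `y ∈ UV ∧ 0 < jV y ∧ (∀ᶠ v in 𝓝 y, c.jac (X, σ v) ≠ 0) ∧ c.Φ (X, σ y) ∈ Sf ∧ A(c.Φ (X, σ y)) = m X` — EXACTLY the hypothesis shape
  `hrowA`∕`hrowB` of ✓`edgeRows_text_twoCorners`.  Mechanism: `σ y = k⁻¹ • U₁`; the carrier, the action through the chart and the event are `pivotAct`-invariant
  BY THE CHART ROWS (no residual-gauge lemma and no `ChartRowsJ` clause is needed); the carrier neighbourhood of `U₁` pulls back along the homeomorphism `k • ·`
  and then along the continuous `σ`.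
* §2 ★★ `edgeRows_text_twoCorners_of_pivotAct_eq` — both corners of an edge by (Q-TUBE) ⟹ (E0) `IsOpen I ∧ 0 ∈ I ∧ 1 ∈ I` and the `EdgeRows` TEXT of the line
  (token-identical body; instantiate `θ := θBal F.L γ (cw * b₀) p₀ J`, `Sf := histGood F ℰp (θBal F.L γ b₀ p₀) K J`, `m := minActionRegPr F J K hJK ε₀`) for the
  locally constant data `x := (A ∣ B)`, `y := (y_A ∣ y_B)` on `I := Iio ½ ∪ Ioi ½`.
* §3 ★ `sliceHessMatrix_eq_hessian_of_locallyConst`, ★★ `hessStd_text_twoCorner` — on that two-corner data the four NAMED slice-Hessian matrices of the DETN row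
  (the body of the line's `hessStd (q ↦ A(c.Φ(x_t q.1, σ q.2))) y_t s` at `s ∈ {0,1}`) ARE the plain `y`-Hessian matrices of `v ↦ A(c.Φ(X, σ v))` at the corner
  coordinates (given the `C²` row there): DETN, like JACW, reads PATH-FREE corner objects.
So, for the EDGE third of `DetRepB`, an organ prover who holds the tube of record through the base minimiser owes exactly (Q-TUBE) at the three other corners —
the QUALITATIVE background-response statement «minimisers over one-bond-moved interior data stay on one transversal slice modulo gauge and pivots»
([Balaban1985Variational] Thm 1 (8)–(10): uniqueness + continuity of the constrained minimiser in the datum, read in px21's chart) — and nothing else there.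

HONEST SCOPE.  Point-set∕group bookkeeping over landed letters; def-free; default heartbeats; proves nothing of (Q-TUBE), DETN, JACW, DET-REP (B), GAP♯, S2β or
the crux 20520; finite-volume∕conditional programme; `YM3TorusSU2` NOT proved; rung R3 = SU(2) YM₃ on T³ — NOT d = 4, NOT infinite volume, NOT a mass gap, NOT
Clay; the Yang–Mills mass gap is NOT proved.

References: [Balaban1985Variational] CMP 102 (1985) Thm 1 (8)–(10) p. 279, (142) p. 299; [Balaban1985Averaging] CMP 98 (1985) (8) p. 19, §E Prop 6 p. 26–27;
[Balaban1987RG1] CMP 109 (1987) (0.13) p. 254; [Helgason2000] Ch. I §1 Thm 1.14 p. 96.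
-/

noncomputable section

open MeasureTheory Filter Topology Set Function Metric
open scoped ContDiff Matrix.Norms.L2Operator
open Literature.MathematicalPhysics.QuantumFieldTheory.Balaban1983to89
open Literature.MathematicalPhysics.QuantumFieldTheory.Balaban1983to89.T3ContinuumYM3Torus
open Literature.MathematicalPhysics.QuantumFieldTheory.Balaban1983to89.T3UnitLawDensityEML
open Literature.MathematicalPhysics.QuantumFieldTheory.Balaban1983to89.T3TiltDescent
open Literature.MathematicalPhysics.QuantumFieldTheory.Balaban1983to89.T3ConstrainedMinimiser (fibre)
open Literature.MathematicalPhysics.QuantumFieldTheory.Balaban1983to89.T4Continuum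
open scoped Literature.MathematicalPhysics.QuantumFieldTheory.Balaban1983to89.T3OrbitAverage
open Summit.QuantumFields.YangMills.Theorems.FluctuationComparisonRegPrIntLWregChain (iterCentralBond iterCentralBond_injective)
open Summit.QuantumFields.YangMills.Theorems.FluctuationComparisonRegPrIntLWregGlue (WindowChart)
open Summit.QuantumFields.YangMills.Theorems.FluctuationComparisonRegPrIntLS2BetaResidualSubgroup
open Summit.QuantumFields.YangMills.Theorems.FluctuationComparisonRegPrIntLS2BetaCornerOfRecord
open Summit.QuantumFields.YangMills.Theorems.FluctuationComparisonRegPrIntLS2BetaTwoCornerEdge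

namespace Summit.QuantumFields.YangMills.Theorems.FluctuationComparisonRegPrIntLS2BetaCornerInTube

variable (F : T3Family) {J K : ℕ} (hJK : J ≤ K)

/-! ## §0 Group bookkeeping for `pivotAct` along the central-bond pivots -/

/-- `k⁻¹ • (k • z) = z` for the enlarged group `residualSubgroup × SU(2)^{pivots}` acting by `pivotAct` along the (injective) iterated central bonds.
[cite: Balaban1985Averaging, (8) p.19] -/
theorem pivotAct_inv_apply (hk : K - J ≤ (F.P K).m + (F.P K).K)
    (k : ↥(residualSubgroup F hJK) × (PBond (F.P K) (K - J) → Matrix.specialUnitaryGroup (Fin 2) ℂ))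
    (z : GaugeField (F.P K) 0 (Matrix.specialUnitaryGroup (Fin 2) ℂ)) :
    pivotAct F hJK (iterCentralBond (P := F.P K) (K - J)) k⁻¹ (pivotAct F hJK (iterCentralBond (P := F.P K) (K - J)) k z) = z := by
  rw [← pivotAct_mul F hJK _ (iterCentralBond_injective (P := F.P K) hk), inv_mul_cancel, pivotAct_one]

/-- `k • (k⁻¹ • z) = z` (the companion). [cite: Balaban1985Averaging, (8) p.19] -/
theorem pivotAct_apply_inv (hk : K - J ≤ (F.P K).m + (F.P K).K)
    (k : ↥(residualSubgroup F hJK) × (PBond (F.P K) (K - J) → Matrix.specialUnitaryGroup (Fin 2) ℂ))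
    (z : GaugeField (F.P K) 0 (Matrix.specialUnitaryGroup (Fin 2) ℂ)) :
    pivotAct F hJK (iterCentralBond (P := F.P K) (K - J)) k (pivotAct F hJK (iterCentralBond (P := F.P K) (K - J)) k⁻¹ z) = z := by
  rw [← pivotAct_mul F hJK _ (iterCentralBond_injective (P := F.P K) hk), mul_inv_cancel, pivotAct_one]

/-- **THE CARRIER NEIGHBOURHOOD PULLS BACK ALONG THE GROUP**: if the carrier `{z | c.jac (X, z) ≠ 0}` is `pivotAct`-invariant (the line's `ChartRows`, clause 2) and
a neighbourhood of `k • z₀`, it is a neighbourhood of `z₀` (`k • ·` is continuous with continuous inverse `k⁻¹ • ·`). [cite: Balaban1987RG1, (0.13) p.254] -/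
theorem carrier_mem_nhds_of_pivotAct (hk : K - J ≤ (F.P K).m + (F.P K).K)
    {Sf : Set (GaugeField (F.P K) 0 (Matrix.specialUnitaryGroup (Fin 2) ℂ))} {O : Set (GaugeField (F.P J) 0 (Matrix.specialUnitaryGroup (Fin 2) ℂ))}
    (c : WindowChart F hJK Sf O) {X : GaugeField (F.P J) 0 (Matrix.specialUnitaryGroup (Fin 2) ℂ)}
    (hcarr : ∀ k z, z ∈ {z : GaugeField (F.P K) 0 (Matrix.specialUnitaryGroup (Fin 2) ℂ) | c.jac (X, z) ≠ 0} →
      pivotAct F hJK (iterCentralBond (P := F.P K) (K - J)) k z ∈ {z : GaugeField (F.P K) 0 (Matrix.specialUnitaryGroup (Fin 2) ℂ) | c.jac (X, z) ≠ 0})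
    (k : ↥(residualSubgroup F hJK) × (PBond (F.P K) (K - J) → Matrix.specialUnitaryGroup (Fin 2) ℂ))
    {z₀ : GaugeField (F.P K) 0 (Matrix.specialUnitaryGroup (Fin 2) ℂ)}
    (h : {z : GaugeField (F.P K) 0 (Matrix.specialUnitaryGroup (Fin 2) ℂ) | c.jac (X, z) ≠ 0} ∈
      𝓝 (pivotAct F hJK (iterCentralBond (P := F.P K) (K - J)) k z₀)) :
    {z : GaugeField (F.P K) 0 (Matrix.specialUnitaryGroup (Fin 2) ℂ) | c.jac (X, z) ≠ 0} ∈ 𝓝 z₀ := by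
  have hcont : Continuous fun z : GaugeField (F.P K) 0 (Matrix.specialUnitaryGroup (Fin 2) ℂ) =>
      pivotAct F hJK (iterCentralBond (P := F.P K) (K - J)) k z :=
    (continuous_pivotAct F hJK (iterCentralBond (P := F.P K) (K - J))).comp₂ continuous_const continuous_id
  filter_upwards [hcont.continuousAt.preimage_mem_nhds h] with z hz
  have h' := hcarr k⁻¹ _ hz
  rwa [pivotAct_inv_apply F hJK hk] at h'

/-! ## §1 The corner rows at a NON-base corner, from (Q-TUBE) -/

/-- ★★ **THE CORNER ROWS BY TEXT AT ANY CORNER WHOSE MINIMISER MEETS THE SLICE MODULO THE GROUP.**  Data: a window chart `c` (the line's `WindowChart F hJK Sf O`),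
an action level `m`, a corner datum `X` with a minimising live history `U₁` over it (`U₁ ∈ argminHist X` unfolded: `U₁ ∈ fibre X`, `U₁ ∈ Sf`, `A(U₁) = m X`), the
transversal `σ` (continuous), the window `UV`, the density `jV` of a tube, and **(Q-TUBE)** a group element `k` and a coordinate `y₁ ∈ UV` with `0 < jV y₁` and
`pivotAct (iterCentralBond (K−J)) k (σ y₁) = U₁`.  Hypotheses on `c` at `X` = four clauses of the line's `ChartRows` VERBATIM (carrier invariance under `pivotAct`;
invariance of `A ∘ c.Φ (X, ·)` on the carrier; invariance of the event `c.Φ (X, ·) ∈ Sf` on the carrier; RECOGNITION: live fibre points of `Sf` are self-charted and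
the carrier is a neighbourhood of them).  Conclusion = the per-value corner rows of `EdgeRows` at `(X, y₁)`, in the hypothesis shape of ✓`edgeRows_text_twoCorners`:
`y₁ ∈ UV ∧ 0 < jV y₁ ∧ (∀ᶠ v in 𝓝 y₁, c.jac (X, σ v) ≠ 0) ∧ c.Φ (X, σ y₁) ∈ Sf ∧ A(c.Φ (X, σ y₁)) = m X`.
Proof: `σ y₁ = k⁻¹ • U₁`; apply the three invariance clauses at the live point `U₁` and recognition `c.Φ (X, U₁) = U₁`; the carrier row along `σ` is §0's pull-back
followed by continuity of `σ`. [cite: Balaban1985Variational, Thm 1 (8)-(10) p.279; Balaban1985Averaging, §E Prop 6 p.26-27; Balaban1987RG1, (0.13) p.254] -/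
theorem cornerRows_text_of_pivotAct_eq (hk : K - J ≤ (F.P K).m + (F.P K).K)
    {Sf : Set (GaugeField (F.P K) 0 (Matrix.specialUnitaryGroup (Fin 2) ℂ))} {O : Set (GaugeField (F.P J) 0 (Matrix.specialUnitaryGroup (Fin 2) ℂ))}
    (c : WindowChart F hJK Sf O) (m : GaugeField (F.P J) 0 (Matrix.specialUnitaryGroup (Fin 2) ℂ) → ℝ)
    {X : GaugeField (F.P J) 0 (Matrix.specialUnitaryGroup (Fin 2) ℂ)} {U₁ : GaugeField (F.P K) 0 (Matrix.specialUnitaryGroup (Fin 2) ℂ)}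
    (hU₁ : U₁ ∈ fibre F ℰp J K hJK X ∧ U₁ ∈ Sf ∧ wilsonAction4 U₁ = m X)
    (hcarr : ∀ k z, z ∈ {z : GaugeField (F.P K) 0 (Matrix.specialUnitaryGroup (Fin 2) ℂ) | c.jac (X, z) ≠ 0} →
      pivotAct F hJK (iterCentralBond (P := F.P K) (K - J)) k z ∈ {z : GaugeField (F.P K) 0 (Matrix.specialUnitaryGroup (Fin 2) ℂ) | c.jac (X, z) ≠ 0})
    (hAinv : ∀ k, ∀ z ∈ {z : GaugeField (F.P K) 0 (Matrix.specialUnitaryGroup (Fin 2) ℂ) | c.jac (X, z) ≠ 0},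
      wilsonAction4 (c.Φ (X, pivotAct F hJK (iterCentralBond (P := F.P K) (K - J)) k z)) = wilsonAction4 (c.Φ (X, z)))
    (hSinv : ∀ k, ∀ z ∈ {z : GaugeField (F.P K) 0 (Matrix.specialUnitaryGroup (Fin 2) ℂ) | c.jac (X, z) ≠ 0},
      c.Φ (X, z) ∈ Sf → c.Φ (X, pivotAct F hJK (iterCentralBond (P := F.P K) (K - J)) k z) ∈ Sf)
    (hrec : ∀ U, descendTo F ℰp J K hJK U = X → U ∈ Sf → (c.jac (X, U) ≠ 0 ∧ c.Φ (X, U) = U) ∧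
      {z : GaugeField (F.P K) 0 (Matrix.specialUnitaryGroup (Fin 2) ℂ) | c.jac (X, z) ≠ 0} ∈ 𝓝 U)
    {dV : ℕ} {σ : EuclideanSpace ℝ (Fin dV) → GaugeField (F.P K) 0 (Matrix.specialUnitaryGroup (Fin 2) ℂ)} (hσ : Continuous σ)
    {UV : Set (EuclideanSpace ℝ (Fin dV))} {jV : EuclideanSpace ℝ (Fin dV) → ℝ}
    {k : ↥(residualSubgroup F hJK) × (PBond (F.P K) (K - J) → Matrix.specialUnitaryGroup (Fin 2) ℂ)} {y₁ : EuclideanSpace ℝ (Fin dV)}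
    (hΘ : pivotAct F hJK (iterCentralBond (P := F.P K) (K - J)) k (σ y₁) = U₁) (hy : y₁ ∈ UV) (hjV : 0 < jV y₁) :
    y₁ ∈ UV ∧ 0 < jV y₁ ∧ (∀ᶠ v in 𝓝 y₁, c.jac (X, σ v) ≠ 0) ∧ c.Φ (X, σ y₁) ∈ Sf ∧ wilsonAction4 (c.Φ (X, σ y₁)) = m X := by
  obtain ⟨hfib, hSf, hmin⟩ := hU₁
  obtain ⟨⟨hjU, hself⟩, hnhds⟩ := hrec U₁ hfib hSf
  -- the slice point is `k⁻¹ • U₁`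
  have hσy : σ y₁ = pivotAct F hJK (iterCentralBond (P := F.P K) (K - J)) k⁻¹ U₁ := by
    rw [← hΘ, pivotAct_inv_apply F hJK hk]
  refine ⟨hy, hjV, ?_, ?_, ?_⟩
  · -- the carrier along `σ` near `y₁`: pull the carrier neighbourhood of `U₁ = k • σ y₁` back along `k • ·`, then along `σ`
    have h1 : {z : GaugeField (F.P K) 0 (Matrix.specialUnitaryGroup (Fin 2) ℂ) | c.jac (X, z) ≠ 0} ∈ 𝓝 (σ y₁) :=
      carrier_mem_nhds_of_pivotAct F hJK hk c hcarr k (by rw [hΘ]; exact hnhds)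
    exact hσ.continuousAt.eventually_mem h1
  · rw [hσy]
    exact hSinv k⁻¹ U₁ hjU (by rw [hself]; exact hSf)
  · rw [hσy, hAinv k⁻¹ U₁ hjU, hself, hmin]

/-- ★ **THE BASE CORNER IS THE CASE `k = 1`, `y = 0`** (consistency with ✓`cornerRows_base_text`: with `σ 0 = U₀` the letter (Q-TUBE) holds trivially at the tube's own
corner). [cite: Balaban1985Averaging, (8) p.19] -/
theorem pivotAct_one_eq_of_base {dV : ℕ} {σ : EuclideanSpace ℝ (Fin dV) → GaugeField (F.P K) 0 (Matrix.specialUnitaryGroup (Fin 2) ℂ)}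
    {U₀ : GaugeField (F.P K) 0 (Matrix.specialUnitaryGroup (Fin 2) ℂ)} (hσ0 : σ 0 = U₀) :
    pivotAct F hJK (iterCentralBond (P := F.P K) (K - J)) 1 (σ 0) = U₀ := by
  rw [pivotAct_one, hσ0]

/-! ## §2 Both corners of an edge by (Q-TUBE): the (E0)-inhabitant of `EdgeRows` -/

/-- ★★ **THE `EdgeRows` TEXT OF LINE g18-1 FOR AN EDGE WHOSE TWO MINIMISERS MEET THE SLICE MODULO THE GROUP.**  Window data `A, B` agreeing off `bnd`, both in the
window `PlaqSmall θ`, minimising live histories `U_A ∈ argminHist A`, `U_B ∈ argminHist B` (unfolded), ONE tube (`σ` continuous, window `UV`, density `jV`), the four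
`ChartRows` clauses at `A` and at `B`, and (Q-TUBE) at both corners (`k_A • σ y_A = U_A`, `k_B • σ y_B = U_B`, `y ∈ UV`, `0 < jV y`).  Conclusion: (E0)
`IsOpen I ∧ 0 ∈ I ∧ 1 ∈ I` for `I := Iio ½ ∪ Ioi ½` and the body of the line's `def EdgeRows` TOKEN FOR TOKEN for the locally constant data `x := (A ∣ B)`,
`y := (y_A ∣ y_B)` (read `θ := θBal F.L γ (cw * b₀) p₀ J`, `Sf := histGood F ℰp (θBal F.L γ b₀ p₀) K J`, `m := minActionRegPr F J K hJK ε₀`).  = §1 twice into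
✓`…S2BetaTwoCornerEdge.edgeRows_text_twoCorners`. [cite: Balaban1985Variational, Thm 1 (8)-(10) p.279; Balaban1985Averaging, §E Prop 6 p.26-27] -/
theorem edgeRows_text_twoCorners_of_pivotAct_eq (hk : K - J ≤ (F.P K).m + (F.P K).K)
    {Sf : Set (GaugeField (F.P K) 0 (Matrix.specialUnitaryGroup (Fin 2) ℂ))} {O : Set (GaugeField (F.P J) 0 (Matrix.specialUnitaryGroup (Fin 2) ℂ))}
    (c : WindowChart F hJK Sf O) (θ : ℝ) (m : GaugeField (F.P J) 0 (Matrix.specialUnitaryGroup (Fin 2) ℂ) → ℝ)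
    (hcarr : ∀ V k z, z ∈ {z : GaugeField (F.P K) 0 (Matrix.specialUnitaryGroup (Fin 2) ℂ) | c.jac (V, z) ≠ 0} →
      pivotAct F hJK (iterCentralBond (P := F.P K) (K - J)) k z ∈ {z : GaugeField (F.P K) 0 (Matrix.specialUnitaryGroup (Fin 2) ℂ) | c.jac (V, z) ≠ 0})
    (hAinv : ∀ V k, ∀ z ∈ {z : GaugeField (F.P K) 0 (Matrix.specialUnitaryGroup (Fin 2) ℂ) | c.jac (V, z) ≠ 0},
      wilsonAction4 (c.Φ (V, pivotAct F hJK (iterCentralBond (P := F.P K) (K - J)) k z)) = wilsonAction4 (c.Φ (V, z)))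
    (hSinv : ∀ V k, ∀ z ∈ {z : GaugeField (F.P K) 0 (Matrix.specialUnitaryGroup (Fin 2) ℂ) | c.jac (V, z) ≠ 0},
      c.Φ (V, z) ∈ Sf → c.Φ (V, pivotAct F hJK (iterCentralBond (P := F.P K) (K - J)) k z) ∈ Sf)
    (hrec : ∀ V U, descendTo F ℰp J K hJK U = V → U ∈ Sf → (c.jac (V, U) ≠ 0 ∧ c.Φ (V, U) = U) ∧
      {z : GaugeField (F.P K) 0 (Matrix.specialUnitaryGroup (Fin 2) ℂ) | c.jac (V, z) ≠ 0} ∈ 𝓝 U)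
    {dV : ℕ} {σ : EuclideanSpace ℝ (Fin dV) → GaugeField (F.P K) 0 (Matrix.specialUnitaryGroup (Fin 2) ℂ)} (hσ : Continuous σ)
    (UV : Set (EuclideanSpace ℝ (Fin dV))) (jV : EuclideanSpace ℝ (Fin dV) → ℝ)
    (bnd : PBond (F.P J) 0) {A B : GaugeField (F.P J) 0 (Matrix.specialUnitaryGroup (Fin 2) ℂ)}
    (hAB : ∀ e', e' ≠ bnd → A e' = B e') (hA : PlaqSmall θ A) (hB : PlaqSmall θ B)
    {UA UB : GaugeField (F.P K) 0 (Matrix.specialUnitaryGroup (Fin 2) ℂ)}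
    (hUA : UA ∈ fibre F ℰp J K hJK A ∧ UA ∈ Sf ∧ wilsonAction4 UA = m A)
    (hUB : UB ∈ fibre F ℰp J K hJK B ∧ UB ∈ Sf ∧ wilsonAction4 UB = m B)
    {kA kB : ↥(residualSubgroup F hJK) × (PBond (F.P K) (K - J) → Matrix.specialUnitaryGroup (Fin 2) ℂ)} {yA yB : EuclideanSpace ℝ (Fin dV)}
    (hΘA : pivotAct F hJK (iterCentralBond (P := F.P K) (K - J)) kA (σ yA) = UA) (hyA : yA ∈ UV) (hjA : 0 < jV yA)
    (hΘB : pivotAct F hJK (iterCentralBond (P := F.P K) (K - J)) kB (σ yB) = UB) (hyB : yB ∈ UV) (hjB : 0 < jV yB) :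
    IsOpen (Iio (2⁻¹ : ℝ) ∪ Ioi 2⁻¹) ∧ (0 : ℝ) ∈ Iio (2⁻¹ : ℝ) ∪ Ioi 2⁻¹ ∧ (1 : ℝ) ∈ Iio (2⁻¹ : ℝ) ∪ Ioi 2⁻¹ ∧
    ((fun s : ℝ => if s < 2⁻¹ then A else B) 0 = A ∧ (fun s : ℝ => if s < 2⁻¹ then A else B) 1 = B ∧
    ∀ s ∈ Iio (2⁻¹ : ℝ) ∪ Ioi 2⁻¹,
      PlaqSmall θ ((fun s : ℝ => if s < 2⁻¹ then A else B) s) ∧ (∀ e', e' ≠ bnd → (fun s : ℝ => if s < 2⁻¹ then A else B) s e' = A e') ∧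
      ContinuousAt (fun s : ℝ => if s < 2⁻¹ then A else B) s ∧
      ContDiffAt ℝ ⊤ (fun s' : ℝ => fun b : PBond (F.P J) 0 =>
        (((fun s : ℝ => if s < 2⁻¹ then A else B) s' b : Matrix.specialUnitaryGroup (Fin 2) ℂ) : Matrix (Fin 2) (Fin 2) ℂ)) s ∧
      (fun s : ℝ => if s < 2⁻¹ then yA else yB) s ∈ UV ∧ 0 < jV ((fun s : ℝ => if s < 2⁻¹ then yA else yB) s) ∧
      (∀ᶠ q in 𝓝 ((s : ℝ), (fun s : ℝ => if s < 2⁻¹ then yA else yB) s),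
        c.jac ((fun s : ℝ => if s < 2⁻¹ then A else B) q.1, σ q.2) ≠ 0) ∧
      c.Φ ((fun s : ℝ => if s < 2⁻¹ then A else B) s, σ ((fun s : ℝ => if s < 2⁻¹ then yA else yB) s)) ∈ Sf ∧
      wilsonAction4 (c.Φ ((fun s : ℝ => if s < 2⁻¹ then A else B) s, σ ((fun s : ℝ => if s < 2⁻¹ then yA else yB) s))) =
        m ((fun s : ℝ => if s < 2⁻¹ then A else B) s) ∧
      ContinuousAt (fun s : ℝ => if s < 2⁻¹ then yA else yB) s) :=
  edgeRows_text_twoCorners F hJK c θ m σ UV jV bnd hAB hA hB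
    (cornerRows_text_of_pivotAct_eq F hJK hk c m hUA (hcarr A) (hAinv A) (hSinv A) (hrec A) hσ hΘA hyA hjA)
    (cornerRows_text_of_pivotAct_eq F hJK hk c m hUB (hcarr B) (hAinv B) (hSinv B) (hrec B) hσ hΘB hyB hjB)

/-! ## §3 DETN's named slice-Hessian matrices at the corners of two-corner data are the plain `y`-Hessians -/

/-- ★ **MATRIX FORM: AT A LOCALLY CONSTANT CORNER THE NAMED SLICE HESSIAN IS THE PLAIN `y`-HESSIAN.**  For `Φ' : α → ℝⁿ → ℝ`, a datum path `x` eventually equal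
to `X` near `s`, a coordinate path `y` with `y s = y₀`, and `Φ' X` of class `C²` at `y₀`: the matrix `[((D[q ↦ D(Φ'(x q.1) q.2) ∘ inr](s, y s)) ∘ inr) eᵢ eⱼ]ᵢⱼ`
(= the body of LINE g18-1's `hessStd (q ↦ Φ' (x q.1) q.2) y s`, standard basis `e` of `ℝⁿ`) equals `[D²(v ↦ Φ' X (y₀ + v))(0) eᵢ eⱼ]ᵢⱼ`.
= ✓`…S2BetaTwoCornerEdge.sliceHessEntry_of_locallyConst` + ✓`…S2BetaBoundPeano.fderiv_fderiv_slice_eq`, entrywise.  READING (DETN, two-corner data of §2): with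
`Φ' a v := A(c.Φ(a, σ v))`, at `s = 0` (`x =ᶠ U`, `y 0 = y_U`) and `s = 1` (`x =ᶠ V`, `y 1 = y_V`) the four named matrices of the DETN row are the `y`-Hessian matrices of
`v ↦ A(c.Φ(X, σ v))` at the four corner coordinates — PATH-FREE corner objects. [cite: Dieudonne1960, Ch. X §2 (10.2.1)-(10.2.3); Balaban1985Variational, Thm 1 (10) p.279] -/
theorem sliceHessMatrix_eq_hessian_of_locallyConst {α : Type*} {n : ℕ}
    (Φ' : α → EuclideanSpace ℝ (Fin n) → ℝ) {x : ℝ → α} {X : α} {s : ℝ} (hx : ∀ᶠ s' in 𝓝 s, x s' = X)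
    {y : ℝ → EuclideanSpace ℝ (Fin n)} {y₀ : EuclideanSpace ℝ (Fin n)} (hy : y s = y₀) (hg : ContDiffAt ℝ 2 (Φ' X) y₀) :
    (Matrix.of fun i j : Fin n => ((fderiv ℝ (fun q : ℝ × EuclideanSpace ℝ (Fin n) =>
        (fderiv ℝ (fun q : ℝ × EuclideanSpace ℝ (Fin n) => Φ' (x q.1) q.2) q).comp
          (ContinuousLinearMap.inr ℝ ℝ (EuclideanSpace ℝ (Fin n)))) (s, y s)).comp
        (ContinuousLinearMap.inr ℝ ℝ (EuclideanSpace ℝ (Fin n))))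
        ((EuclideanSpace.basisFun (Fin n) ℝ) i) ((EuclideanSpace.basisFun (Fin n) ℝ) j)) =
    Matrix.of fun i j : Fin n => fderiv ℝ (fderiv ℝ (fun v : EuclideanSpace ℝ (Fin n) => Φ' X (y₀ + v))) 0
        ((EuclideanSpace.basisFun (Fin n) ℝ) i) ((EuclideanSpace.basisFun (Fin n) ℝ) j) := by
  ext i j
  rw [Matrix.of_apply, Matrix.of_apply, sliceHessEntry_of_locallyConst Φ' hx (y s), hy]
  have hf : ContDiffAt ℝ 2 (fun q : ℝ × EuclideanSpace ℝ (Fin n) => Φ' X q.2) (s, y₀) :=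
    hg.comp (s, y₀) contDiffAt_snd
  exact (FluctuationComparisonRegPrIntLS2BetaBoundPeano.fderiv_fderiv_slice_eq hf _ _).symm

/-- The two-corner datum path of §2 is eventually `A` near `s = 0` and eventually `B` near `s = 1`; the coordinate path reads `y_A`, `y_B` there.
[cite: Balaban1985Variational, Thm 1 (8) p.279 (bookkeeping)] -/
theorem twoCorner_eventually {α β : Type*} (A B : α) (yA yB : β) :
    (∀ᶠ s' in 𝓝 (0 : ℝ), (fun s : ℝ => if s < 2⁻¹ then A else B) s' = A) ∧ (fun s : ℝ => if s < 2⁻¹ then yA else yB) 0 = yA ∧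
    (∀ᶠ s' in 𝓝 (1 : ℝ), (fun s : ℝ => if s < 2⁻¹ then A else B) s' = B) ∧ (fun s : ℝ => if s < 2⁻¹ then yA else yB) 1 = yB := by
  have h0 : (0 : ℝ) < 2⁻¹ := by norm_num
  have h1 : (2⁻¹ : ℝ) < 1 := by norm_num
  refine ⟨?_, if_pos h0, ?_, if_neg (not_lt.2 h1.le)⟩
  · filter_upwards [Iio_mem_nhds h0] with s' hs'
    exact if_pos hs'
  · filter_upwards [Ioi_mem_nhds h1] with s' hs'
    exact if_neg (not_lt.2 (le_of_lt hs'))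

/-- ★★ **DETN's FOUR NAMED MATRICES IN CORNER FORM.**  For the two-corner data of an edge `A → B` (`x := (A ∣ B)`, `y := (y_A ∣ y_B)`) read through a chart map
`Ψ : datum × fine field → fine field` (instantiate `Ψ := c.Φ`), a transversal `σ` and an amplitude `Act` (instantiate `Act := wilsonAction4`), with
`v ↦ Act (Ψ (A, σ v))` of class `C²` at `y_A` and `v ↦ Act (Ψ (B, σ v))` of class `C²` at `y_B` (✓(C2″)-type rows of the lineage): the bodies of
`hessStd (q ↦ Act (Ψ (x q.1, σ q.2))) y 0` and `… y 1` equal the `y`-Hessian matrices of `v ↦ Act (Ψ (A, σ (y_A + v)))`, `v ↦ Act (Ψ (B, σ (y_B + v)))` at `0`.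
So the DETN row of `def DetRepB`, on the (E0)-inhabitant of `EdgeRows`, is a statement about FOUR PATH-FREE corner Hessians (and `jV` at four corner coordinates).
[cite: Dieudonne1960, Ch. X §2 (10.2.1)-(10.2.3); Balaban1985Variational, Thm 1 (10) p.279] -/
theorem hessStd_text_twoCorner {D Z : Type*} {n : ℕ} (Ψ : D × Z → Z) (Act : Z → ℝ) (σ : EuclideanSpace ℝ (Fin n) → Z)
    (A B : D) (yA yB : EuclideanSpace ℝ (Fin n))
    (hgA : ContDiffAt ℝ 2 (fun v : EuclideanSpace ℝ (Fin n) => Act (Ψ (A, σ v))) yA)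
    (hgB : ContDiffAt ℝ 2 (fun v : EuclideanSpace ℝ (Fin n) => Act (Ψ (B, σ v))) yB) :
    ((Matrix.of fun i j : Fin n => ((fderiv ℝ (fun q : ℝ × EuclideanSpace ℝ (Fin n) =>
        (fderiv ℝ (fun q : ℝ × EuclideanSpace ℝ (Fin n) =>
            Act (Ψ ((fun s : ℝ => if s < 2⁻¹ then A else B) q.1, σ q.2))) q).comp
          (ContinuousLinearMap.inr ℝ ℝ (EuclideanSpace ℝ (Fin n))))
          ((0 : ℝ), (fun s : ℝ => if s < 2⁻¹ then yA else yB) 0)).comp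
        (ContinuousLinearMap.inr ℝ ℝ (EuclideanSpace ℝ (Fin n))))
        ((EuclideanSpace.basisFun (Fin n) ℝ) i) ((EuclideanSpace.basisFun (Fin n) ℝ) j)) =
      Matrix.of fun i j : Fin n => fderiv ℝ (fderiv ℝ (fun v : EuclideanSpace ℝ (Fin n) => Act (Ψ (A, σ (yA + v))))) 0
        ((EuclideanSpace.basisFun (Fin n) ℝ) i) ((EuclideanSpace.basisFun (Fin n) ℝ) j)) ∧
    ((Matrix.of fun i j : Fin n => ((fderiv ℝ (fun q : ℝ × EuclideanSpace ℝ (Fin n) =>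
        (fderiv ℝ (fun q : ℝ × EuclideanSpace ℝ (Fin n) =>
            Act (Ψ ((fun s : ℝ => if s < 2⁻¹ then A else B) q.1, σ q.2))) q).comp
          (ContinuousLinearMap.inr ℝ ℝ (EuclideanSpace ℝ (Fin n))))
          ((1 : ℝ), (fun s : ℝ => if s < 2⁻¹ then yA else yB) 1)).comp
        (ContinuousLinearMap.inr ℝ ℝ (EuclideanSpace ℝ (Fin n))))
        ((EuclideanSpace.basisFun (Fin n) ℝ) i) ((EuclideanSpace.basisFun (Fin n) ℝ) j)) =
      Matrix.of fun i j : Fin n => fderiv ℝ (fderiv ℝ (fun v : EuclideanSpace ℝ (Fin n) => Act (Ψ (B, σ (yB + v))))) 0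
        ((EuclideanSpace.basisFun (Fin n) ℝ) i) ((EuclideanSpace.basisFun (Fin n) ℝ) j)) := by
  obtain ⟨hx0, hy0, hx1, hy1⟩ := twoCorner_eventually A B yA yB
  exact ⟨sliceHessMatrix_eq_hessian_of_locallyConst (fun (a : D) (v : EuclideanSpace ℝ (Fin n)) => Act (Ψ (a, σ v)))
      (x := fun s : ℝ => if s < 2⁻¹ then A else B) (X := A) (s := 0) hx0
      (y := fun s : ℝ => if s < 2⁻¹ then yA else yB) (y₀ := yA) hy0 hgA,
    sliceHessMatrix_eq_hessian_of_locallyConst (fun (a : D) (v : EuclideanSpace ℝ (Fin n)) => Act (Ψ (a, σ v)))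
      (x := fun s : ℝ => if s < 2⁻¹ then A else B) (X := B) (s := 1) hx1
      (y := fun s : ℝ => if s < 2⁻¹ then yA else yB) (y₀ := yB) hy1 hgB⟩

end Summit.QuantumFields.YangMills.Theorems.FluctuationComparisonRegPrIntLS2BetaCornerInTube

end
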